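import Literature.MathematicalPhysics.QuantumFieldTheory.Balaban1983to89.B9Ineq369CurvatureSmallAtLettersY
import Literature.MathematicalPhysics.QuantumFieldTheory.Balaban1983to89.B4Lower18

/-!
# `Balaban1983to89.B9Thm31SiteCoerciveFlatBlockY` — T. Bałaban, *Propagators for lattice gauge theories in a background field*, Commun. Math.
# Phys. **99** (1985) 389–434 [Balaban1985BackgroundPropagators] Thm 3.1 p. 397 ∕ Thm 3.11 p. 416 with [4] = *Propagators … II*
# [Balaban1984PropagatorsII] (2.13)–(2.14) p. 225: THE FLAT BLOCK STEP OF THE SITE-OPERATOR COERCIVITY — the Poincaré–mean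
# decomposition of an `M_N(ℂ)`-valued lattice function on ONE block of a block-union region, in the Hilbert–Schmidt currency of
# def-Y's letters, and the elementary coercivity `min(1∕P, κ·|B|)·Σ_B HS(Ψ) ≤ Σ_{bonds⊂B} HS(δΨ) + κ·HS(Σ_B Ψ)` (file 1 of 3)

statement-level skeleton of published theorems with citation tags; proofs where landed; nothing here is a claim about the Yang–Mills mass gap

THE PRINT (verbatim).  [B9] p. 395: *«Assuming some regularity of the configuration U it can be easily shown that the operator Δ′_a is
positive»*; Thm 3.11 p. 416: *«the operators Δ′_a, G′, (Q′G′²Q′\*)⁻¹, Δ_a, G are positive definite … The proof can be reduced to a proof of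
positivity of the operators G_□ … Doing the gauge transformation we get U = e^{iηA} with A small … In [4] we have proved that the operator
G_□(1) is positive»*; [4] p. 225: *«The operator G′ = Δ′_a^{−1} is a well defined, positive operator»*, (2.14):
`⟨λ, Δ′_aλ⟩ = ‖∇λ‖² + Σ_j a_j Σ_{y∈Λ_j} (L^jη)^{d−2}|(Q′_jλ)(y)|²`.

WHY THIS FILE (cell `pub-ymgap`, Track A node N06 [B9], width seat `pub-ymgap-dag-n06-w1`; W-SEAT-START-LIST v3 § n06 item 1 «Thm 3.1 invertibility at
the instance»).  At def-Y's letters of record the QUALITATIVE statement is a theorem for every unitary-valued background (dag-n06-j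
`B9Thm311DeltaPrimePos.isUnit_deltaPrimeAY_parSymY`, from the sum-of-squares identity `trIP_deltaPrimeAY_eq`).  The QUANTITATIVE statement print uses —
a lower bound for `⟨Φ, Δ′_a(U)Φ⟩` UNIFORM in the background over the class (3.35), in the volume and in the number of levels — is the content of
Thm 3.1's positivity step, and its mechanism (p. 416) is BLOCK BY BLOCK: in a cube gauge the background is `O(Mα₀L^{−j})`-close to `1` on a block of
level `j`, so the block's share of (2.14)'s form is the FLAT block form up to a relative error `O((Mα₀)²)`, and the flat block form is coercive by a
discrete Poincaré inequality plus the block-average («mass») term.  THIS FILE is the flat block step, at the fibre `M_N(ℂ)` and on the carriers the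
record uses (block-union regions of `ℤ^{d+1}`, `B4Lower18.rblock_poincare`); file 2 (`B9Thm31SiteCoerciveGaugeBlockY`) is the gauge comparison on a
block, file 3 (`B9Thm31SiteCoerciveReg335Y`) the assembly on def-Y's `Δ′_a(U) = deltaPrimeAY i (parSymY i) U` over `(bg9K (M_N ℂ) G i).Reg335`.
PRIOR ART DECLARED: the real-valued variance algebra and the block Poincaré inequality are the tree's (`Beta.BlockPoincare`, `B4Lower18.rblock_poincare`,
constant `ℓ′(ℓ′+1)∕2` for block side `ℓ′+1`); the pub-balaban NE9 chain proves the analogous site coercivity at ITS one-step letters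
(`B9Thm311SitePrimeFormCoercivePlaquette`, `TSite` carriers) — nothing of it is restated or imported; here only the `M_N(ℂ)`-valued bookkeeping is new.

WHAT IS PROVED (sorry-free; 0 `def`; [folklore] finite-dimensional algebra; no inequality of the papers is asserted).
* §1 fibre bookkeeping (private): `hs_eq_sum_re_sq_add_im_sq` (`HS(X) = Σ_{ab} (Re X_{ab})² + (Im X_{ab})²`), `re_sum_apply` ∕ `im_sum_apply` (entries of a sum of
  matrices), `hs_sum_eq` (`HS(Σ_z Ψ z)` through the real coordinates).
* §2 real-valued, one block `b` of a block-union region `R ⊂ ℤ^{d+1}` (block side `ℓ′ + 1 ≥ 2`): ★ `real_sum_sq_le_poincare_mean`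
  (`Σ_{z∈b} f(z)² ≤ P·Σ_{bonds⊂b}(δf)² + (Σ_{z∈b} f(z))²∕|b|`, `P = ℓ′(ℓ′+1)∕2`, `|b| = (ℓ′+1)^{d+1}`).
* §3 `M_N(ℂ)`-valued: ★★ `hs_sum_le_poincare_mean` (the same with `HS` in place of squares — print's flat block form, [4] (2.14) on one block).
* §4 `coercive_arith` (private, the real arithmetic), ★★ `hs_block_coercive`: for `0 ≤ κ`, `min(1∕P, κ·|b|)·Σ_{z∈b} HS(Ψ z) ≤ Σ_{bonds⊂b} HS(Ψ(tgt) − Ψ(src))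
  + κ·HS(Σ_{z∈b} Ψ z)` — the flat block coercivity with the block-average mass `κ·|b|` (at def-Y's letters `κ = levC_j`, `κ·|b| = a_j L^{−2j}`, file 3).
* §5 the same two statements with the block side written `n ≥ 2` (`hs_sum_le_poincare_mean_side`, ★★ `hs_block_coercive_side`; `n = L^j` in files 2–3).
HONEST SCOPE.  Elementary; the estimate of [B9] Thm 3.1 ∕ [4] is NOT asserted here (this is its flat one-block input in the record's currency); NOT a
node discharge, NOT summit progress; count-neutral; one finite lattice at a time; nothing continuum ∕ OS ∕ mass gap ∕ Clay.
-/

noncomputable section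

namespace Literature.MathematicalPhysics.QuantumFieldTheory.Balaban1983to89.B9Thm31SiteCoerciveFlatBlockY

open Literature.MathematicalPhysics.QuantumFieldTheory.Balaban1983to89
open Literature.MathematicalPhysics.QuantumFieldTheory.Balaban1983to89.B4Reflection242 (boxDom blk)
open Literature.MathematicalPhysics.QuantumFieldTheory.Balaban1983to89.B4Lower18 (IsBlockUnion RBond rsrc rtgt rblk rblock_poincare card_filter_rblk)
open Literature.MathematicalPhysics.QuantumFieldTheory.Balaban1983to89.Beta.BlockPoincare (avg sum_sq_eq_var_add)
open Literature.MathematicalPhysics.QuantumFieldTheory.Balaban1983to89.B9Ineq369CurvatureSmallAtLettersY (hs_nonneg)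
open scoped Matrix

/-! ## §1 Fibre bookkeeping: `HS` through the real coordinates -/

section Fibre

variable {N : ℕ}

/-- `HS(X) = Σ_{ab} ((Re X_{ab})² + (Im X_{ab})²)`. [folklore] -/
private theorem hs_eq_sum_re_sq_add_im_sq (X : Matrix (Fin N) (Fin N) ℂ) :
    ∑ a, ∑ b, ‖X a b‖ ^ 2 = ∑ a, ∑ b, ((X a b).re ^ 2 + (X a b).im ^ 2) := by
  refine Finset.sum_congr rfl fun a _ => Finset.sum_congr rfl fun b _ => ?_
  rw [Complex.sq_norm, Complex.normSq_apply]; ring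

/-- the real part of an entry of a finite sum of matrices. [folklore] -/
private theorem re_sum_apply {ι : Type*} (s : Finset ι) (Ψ : ι → Matrix (Fin N) (Fin N) ℂ) (a b : Fin N) :
    ((∑ z ∈ s, Ψ z) a b).re = ∑ z ∈ s, (Ψ z a b).re := by
  rw [Matrix.sum_apply, Complex.re_sum]

/-- the imaginary part of an entry of a finite sum of matrices. [folklore] -/
private theorem im_sum_apply {ι : Type*} (s : Finset ι) (Ψ : ι → Matrix (Fin N) (Fin N) ℂ) (a b : Fin N) :
    ((∑ z ∈ s, Ψ z) a b).im = ∑ z ∈ s, (Ψ z a b).im := by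
  rw [Matrix.sum_apply, Complex.im_sum]

/-- `HS` of a finite sum of matrices through the real coordinates. [folklore] -/
private theorem hs_sum_eq {ι : Type*} (s : Finset ι) (Ψ : ι → Matrix (Fin N) (Fin N) ℂ) :
    ∑ a, ∑ b, ‖(∑ z ∈ s, Ψ z) a b‖ ^ 2 = ∑ a, ∑ b, ((∑ z ∈ s, (Ψ z a b).re) ^ 2 + (∑ z ∈ s, (Ψ z a b).im) ^ 2) := by
  rw [hs_eq_sum_re_sq_add_im_sq]
  refine Finset.sum_congr rfl fun a _ => Finset.sum_congr rfl fun b _ => ?_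
  rw [re_sum_apply, im_sum_apply]

end Fibre

/-! ## §2 Real-valued: the Poincaré–mean decomposition on one block -/

section Real

variable {d ℓ' : ℕ} (hℓ : 1 ≤ ℓ') {R : Finset (Fin (d + 1) → ℤ)} (hR : IsBlockUnion (ℓ' + 1) R)
include hℓ hR

/-- ★ ON ONE BLOCK `b` (side `ℓ′+1 ≥ 2`) of a block-union region: `Σ_{z∈b} f(z)² ≤ P·Σ_{bonds⊂b}(f(tgt) − f(src))² + (Σ_{z∈b} f(z))²∕|b|` with
`P = ℓ′(ℓ′+1)∕2` and `|b| = (ℓ′+1)^{d+1}` — variance + mean, the variance bounded by the block Poincaré inequality.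
[folklore] [cite: Balaban1984PropagatorsII, (2.14) p.225 (one block of the form), bookkeeping] -/
theorem real_sum_sq_le_poincare_mean (b : ↥(R.image (blk (ℓ' + 1)))) (f : ↥R → ℝ) :
    ∑ z ∈ Finset.univ.filter (fun z : ↥R => rblk (ℓ' + 1) R z = b), f z ^ 2
      ≤ (ℓ' : ℝ) * (ℓ' + 1) / 2 *
          ∑ k ∈ Finset.univ.filter (fun k : RBond R => rblk (ℓ' + 1) R (rsrc k) = b ∧ rblk (ℓ' + 1) R (rtgt k) = b),
            (f (rtgt k) - f (rsrc k)) ^ 2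
        + (∑ z ∈ Finset.univ.filter (fun z : ↥R => rblk (ℓ' + 1) R z = b), f z) ^ 2 / ((ℓ' : ℝ) + 1) ^ (d + 1) := by
  set B := Finset.univ.filter (fun z : ↥R => rblk (ℓ' + 1) R z = b) with hB
  have hcard : (B.card : ℝ) = ((ℓ' : ℝ) + 1) ^ (d + 1) := by
    rw [hB, card_filter_rblk (by omega) hR b]; push_cast; ring
  have hpos : (0 : ℝ) < ((ℓ' : ℝ) + 1) ^ (d + 1) := by positivity
  have hvar := rblock_poincare hℓ hR b f
  have hdec := sum_sq_eq_var_add B f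
  have hmean : (B.card : ℝ) * avg B f ^ 2 = (∑ z ∈ B, f z) ^ 2 / ((ℓ' : ℝ) + 1) ^ (d + 1) := by
    rw [avg, hcard, div_pow]
    field_simp
  rw [hdec, hmean]
  exact add_le_add hvar le_rfl

end Real

/-! ## §3 `M_N(ℂ)`-valued: the Poincaré–mean decomposition in the Hilbert–Schmidt currency -/

section MatrixValued

variable {d ℓ' : ℕ} (hℓ : 1 ≤ ℓ') {R : Finset (Fin (d + 1) → ℤ)} (hR : IsBlockUnion (ℓ' + 1) R) {N : ℕ}
include hℓ hR

/-- ★★ THE FLAT BLOCK FORM, `M_N(ℂ)`-VALUED: on one block `b` of a block-union region,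
`Σ_{z∈b} HS(Ψ z) ≤ P·Σ_{bonds⊂b} HS(Ψ(tgt) − Ψ(src)) + HS(Σ_{z∈b} Ψ z)∕|b|`, `P = ℓ′(ℓ′+1)∕2`, `|b| = (ℓ′+1)^{d+1}` — [4] (2.14)'s flat block
bookkeeping read entrywise through `Re`, `Im`. [folklore] [cite: Balaban1984PropagatorsII, (2.14) p.225; Balaban1985BackgroundPropagators, Thm 3.11 p.416 («G_□(1) is positive»)] -/
theorem hs_sum_le_poincare_mean (b : ↥(R.image (blk (ℓ' + 1)))) (Ψ : ↥R → Matrix (Fin N) (Fin N) ℂ) :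
    ∑ z ∈ Finset.univ.filter (fun z : ↥R => rblk (ℓ' + 1) R z = b), ∑ a, ∑ c, ‖Ψ z a c‖ ^ 2
      ≤ (ℓ' : ℝ) * (ℓ' + 1) / 2 *
          ∑ k ∈ Finset.univ.filter (fun k : RBond R => rblk (ℓ' + 1) R (rsrc k) = b ∧ rblk (ℓ' + 1) R (rtgt k) = b),
            ∑ a, ∑ c, ‖(Ψ (rtgt k) - Ψ (rsrc k)) a c‖ ^ 2
        + (∑ a, ∑ c, ‖(∑ z ∈ Finset.univ.filter (fun z : ↥R => rblk (ℓ' + 1) R z = b), Ψ z) a c‖ ^ 2)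
            / ((ℓ' : ℝ) + 1) ^ (d + 1) := by
  set B := Finset.univ.filter (fun z : ↥R => rblk (ℓ' + 1) R z = b) with hB
  set K := Finset.univ.filter (fun k : RBond R => rblk (ℓ' + 1) R (rsrc k) = b ∧ rblk (ℓ' + 1) R (rtgt k) = b) with hK
  set P : ℝ := (ℓ' : ℝ) * (ℓ' + 1) / 2 with hP
  set V : ℝ := ((ℓ' : ℝ) + 1) ^ (d + 1) with hV
  -- the real coordinates
  have hre : ∀ a c : Fin N, ∑ z ∈ B, (Ψ z a c).re ^ 2
      ≤ P * ∑ k ∈ K, ((Ψ (rtgt k) a c).re - (Ψ (rsrc k) a c).re) ^ 2 + (∑ z ∈ B, (Ψ z a c).re) ^ 2 / V :=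
    fun a c => real_sum_sq_le_poincare_mean hℓ hR b (fun z => (Ψ z a c).re)
  have him : ∀ a c : Fin N, ∑ z ∈ B, (Ψ z a c).im ^ 2
      ≤ P * ∑ k ∈ K, ((Ψ (rtgt k) a c).im - (Ψ (rsrc k) a c).im) ^ 2 + (∑ z ∈ B, (Ψ z a c).im) ^ 2 / V :=
    fun a c => real_sum_sq_le_poincare_mean hℓ hR b (fun z => (Ψ z a c).im)
  -- rewrite the three HS-quantities through the coordinates
  have hL : ∑ z ∈ B, ∑ a, ∑ c, ‖Ψ z a c‖ ^ 2 = ∑ a, ∑ c, (∑ z ∈ B, (Ψ z a c).re ^ 2 + ∑ z ∈ B, (Ψ z a c).im ^ 2) := by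
    rw [Finset.sum_comm]
    refine Finset.sum_congr rfl fun a _ => ?_
    rw [Finset.sum_comm]
    refine Finset.sum_congr rfl fun c _ => ?_
    rw [← Finset.sum_add_distrib]
    refine Finset.sum_congr rfl fun z _ => ?_
    rw [Complex.sq_norm, Complex.normSq_apply]; ring
  have hD : ∑ k ∈ K, ∑ a, ∑ c, ‖(Ψ (rtgt k) - Ψ (rsrc k)) a c‖ ^ 2
      = ∑ a, ∑ c, (∑ k ∈ K, ((Ψ (rtgt k) a c).re - (Ψ (rsrc k) a c).re) ^ 2
          + ∑ k ∈ K, ((Ψ (rtgt k) a c).im - (Ψ (rsrc k) a c).im) ^ 2) := by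
    rw [Finset.sum_comm]
    refine Finset.sum_congr rfl fun a _ => ?_
    rw [Finset.sum_comm]
    refine Finset.sum_congr rfl fun c _ => ?_
    rw [← Finset.sum_add_distrib]
    refine Finset.sum_congr rfl fun k _ => ?_
    rw [Complex.sq_norm, Complex.normSq_apply, Matrix.sub_apply, Complex.sub_re, Complex.sub_im]; ring
  have hM : ∑ a, ∑ c, ‖(∑ z ∈ B, Ψ z) a c‖ ^ 2 = ∑ a, ∑ c, ((∑ z ∈ B, (Ψ z a c).re) ^ 2 + (∑ z ∈ B, (Ψ z a c).im) ^ 2) :=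
    hs_sum_eq B Ψ
  calc ∑ z ∈ B, ∑ a, ∑ c, ‖Ψ z a c‖ ^ 2
      = ∑ a, ∑ c, (∑ z ∈ B, (Ψ z a c).re ^ 2 + ∑ z ∈ B, (Ψ z a c).im ^ 2) := hL
    _ ≤ ∑ a, ∑ c, (P * (∑ k ∈ K, ((Ψ (rtgt k) a c).re - (Ψ (rsrc k) a c).re) ^ 2
          + ∑ k ∈ K, ((Ψ (rtgt k) a c).im - (Ψ (rsrc k) a c).im) ^ 2)
          + ((∑ z ∈ B, (Ψ z a c).re) ^ 2 + (∑ z ∈ B, (Ψ z a c).im) ^ 2) / V) := by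
        refine Finset.sum_le_sum fun a _ => Finset.sum_le_sum fun c _ => ?_
        have h1 := hre a c
        have h2 := him a c
        rw [mul_add, add_div]
        linarith
    _ = P * ∑ a, ∑ c, (∑ k ∈ K, ((Ψ (rtgt k) a c).re - (Ψ (rsrc k) a c).re) ^ 2
          + ∑ k ∈ K, ((Ψ (rtgt k) a c).im - (Ψ (rsrc k) a c).im) ^ 2)
        + (∑ a, ∑ c, ((∑ z ∈ B, (Ψ z a c).re) ^ 2 + (∑ z ∈ B, (Ψ z a c).im) ^ 2)) / V := by
        rw [Finset.mul_sum, Finset.sum_div, ← Finset.sum_add_distrib]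
        refine Finset.sum_congr rfl fun a _ => ?_
        rw [Finset.mul_sum, Finset.sum_div, ← Finset.sum_add_distrib]
    _ = _ := by rw [hD, hM]

/-! ## §4 The flat block coercivity with the block-average mass -/

omit hℓ hR in
/-- the arithmetic of the flat block coercivity: `m ≤ P·X + Y∕V` with `X, Y ≥ 0` gives `min(1∕P, κV)·m ≤ X + κ·Y`. [folklore] -/
private theorem coercive_arith {P V κ X Y m : ℝ} (hP : 0 < P) (hV : 0 < V) (hκ : 0 ≤ κ) (hX : 0 ≤ X) (hY : 0 ≤ Y)
    (hm : m ≤ P * X + Y / V) : min (1 / P) (κ * V) * m ≤ X + κ * Y := by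
  have hmin1 : min (1 / P) (κ * V) ≤ 1 / P := min_le_left _ _
  have hmin2 : min (1 / P) (κ * V) ≤ κ * V := min_le_right _ _
  have hmin0 : 0 ≤ min (1 / P) (κ * V) := le_min (by positivity) (mul_nonneg hκ hV.le)
  have hYV : 0 ≤ Y / V := div_nonneg hY hV.le
  calc min (1 / P) (κ * V) * m ≤ min (1 / P) (κ * V) * (P * X + Y / V) := mul_le_mul_of_nonneg_left hm hmin0
    _ = min (1 / P) (κ * V) * P * X + min (1 / P) (κ * V) * (Y / V) := by ring
    _ ≤ 1 / P * P * X + κ * V * (Y / V) := by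
        have h1 : min (1 / P) (κ * V) * P ≤ 1 / P * P := mul_le_mul_of_nonneg_right hmin1 hP.le
        have h2 : min (1 / P) (κ * V) * P * X ≤ 1 / P * P * X := mul_le_mul_of_nonneg_right h1 hX
        have h3 : min (1 / P) (κ * V) * (Y / V) ≤ κ * V * (Y / V) := mul_le_mul_of_nonneg_right hmin2 hYV
        exact add_le_add h2 h3
    _ = X + κ * Y := by
        field_simp

/-- ★★ THE FLAT BLOCK COERCIVITY: for `0 ≤ κ`, on one block `b` (side `ℓ′+1 ≥ 2`, `|b| = (ℓ′+1)^{d+1}`, `P = ℓ′(ℓ′+1)∕2`) of a block-union region,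
`min(1∕P, κ·|b|)·Σ_{z∈b} HS(Ψ z) ≤ Σ_{bonds⊂b} HS(Ψ(tgt) − Ψ(src)) + κ·HS(Σ_{z∈b} Ψ z)` — [4]'s «G′ = Δ′_a^{−1} is well defined» ∕ [B9] p. 416 «G_□(1) is
positive» with an explicit block constant. [folklore] [cite: Balaban1984PropagatorsII, p.225, (2.14); Balaban1985BackgroundPropagators, Thm 3.11 p.416] -/
theorem hs_block_coercive (b : ↥(R.image (blk (ℓ' + 1)))) (Ψ : ↥R → Matrix (Fin N) (Fin N) ℂ) {κ : ℝ} (hκ : 0 ≤ κ) :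
    min (1 / ((ℓ' : ℝ) * (ℓ' + 1) / 2)) (κ * ((ℓ' : ℝ) + 1) ^ (d + 1)) *
        ∑ z ∈ Finset.univ.filter (fun z : ↥R => rblk (ℓ' + 1) R z = b), ∑ a, ∑ c, ‖Ψ z a c‖ ^ 2
      ≤ ∑ k ∈ Finset.univ.filter (fun k : RBond R => rblk (ℓ' + 1) R (rsrc k) = b ∧ rblk (ℓ' + 1) R (rtgt k) = b),
            ∑ a, ∑ c, ‖(Ψ (rtgt k) - Ψ (rsrc k)) a c‖ ^ 2
        + κ * ∑ a, ∑ c, ‖(∑ z ∈ Finset.univ.filter (fun z : ↥R => rblk (ℓ' + 1) R z = b), Ψ z) a c‖ ^ 2 := by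
  have hP0 : 0 < (ℓ' : ℝ) * (ℓ' + 1) / 2 := by
    have : (1 : ℝ) ≤ ℓ' := by exact_mod_cast hℓ
    nlinarith
  have hV0 : (0 : ℝ) < ((ℓ' : ℝ) + 1) ^ (d + 1) := by positivity
  exact coercive_arith hP0 hV0 hκ (Finset.sum_nonneg fun _ _ => hs_nonneg _) (hs_nonneg _)
    (hs_sum_le_poincare_mean hℓ hR b Ψ)

end MatrixValued

/-! ## §5 The same two statements for a block side `n ≥ 2` written as `n` (the form files 2–3 consume, `n = L^j`) -/

section SideN

variable {d n : ℕ} (hn : 2 ≤ n) {R : Finset (Fin (d + 1) → ℤ)} (hR : IsBlockUnion n R) {N : ℕ}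
include hn hR

/-- ★★ `hs_sum_le_poincare_mean` for a block side written `n ≥ 2`: `Σ_{z∈b} HS(Ψ z) ≤ ((n−1)n∕2)·Σ_{bonds⊂b} HS(δΨ) + HS(Σ_{z∈b} Ψ z)∕n^{d+1}`.
[folklore] [cite: Balaban1984PropagatorsII, (2.14) p.225; Balaban1985BackgroundPropagators, Thm 3.11 p.416] -/
theorem hs_sum_le_poincare_mean_side (b : ↥(R.image (blk n))) (Ψ : ↥R → Matrix (Fin N) (Fin N) ℂ) :
    ∑ z ∈ Finset.univ.filter (fun z : ↥R => rblk n R z = b), ∑ a, ∑ c, ‖Ψ z a c‖ ^ 2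
      ≤ ((n : ℝ) - 1) * n / 2 *
          ∑ k ∈ Finset.univ.filter (fun k : RBond R => rblk n R (rsrc k) = b ∧ rblk n R (rtgt k) = b),
            ∑ a, ∑ c, ‖(Ψ (rtgt k) - Ψ (rsrc k)) a c‖ ^ 2
        + (∑ a, ∑ c, ‖(∑ z ∈ Finset.univ.filter (fun z : ↥R => rblk n R z = b), Ψ z) a c‖ ^ 2) / (n : ℝ) ^ (d + 1) := by
  obtain ⟨ℓ', rfl⟩ : ∃ ℓ', n = ℓ' + 1 := ⟨n - 1, by omega⟩
  have h := hs_sum_le_poincare_mean (by omega) hR b Ψ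
  have e1 : (((ℓ' + 1 : ℕ) : ℝ) - 1) * ((ℓ' + 1 : ℕ) : ℝ) / 2 = (ℓ' : ℝ) * (ℓ' + 1) / 2 := by push_cast; ring
  have e2 : (((ℓ' + 1 : ℕ) : ℝ)) ^ (d + 1) = ((ℓ' : ℝ) + 1) ^ (d + 1) := by push_cast; ring
  rw [e1, e2]
  exact h

/-- ★★ `hs_block_coercive` for a block side written `n ≥ 2`: `min(2∕((n−1)n), κ·n^{d+1})·Σ_{z∈b} HS(Ψ z) ≤ Σ_{bonds⊂b} HS(δΨ) + κ·HS(Σ_{z∈b} Ψ z)`.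
[folklore] [cite: Balaban1984PropagatorsII, p.225, (2.14); Balaban1985BackgroundPropagators, Thm 3.11 p.416] -/
theorem hs_block_coercive_side (b : ↥(R.image (blk n))) (Ψ : ↥R → Matrix (Fin N) (Fin N) ℂ) {κ : ℝ} (hκ : 0 ≤ κ) :
    min (1 / (((n : ℝ) - 1) * n / 2)) (κ * (n : ℝ) ^ (d + 1)) *
        ∑ z ∈ Finset.univ.filter (fun z : ↥R => rblk n R z = b), ∑ a, ∑ c, ‖Ψ z a c‖ ^ 2
      ≤ ∑ k ∈ Finset.univ.filter (fun k : RBond R => rblk n R (rsrc k) = b ∧ rblk n R (rtgt k) = b),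
            ∑ a, ∑ c, ‖(Ψ (rtgt k) - Ψ (rsrc k)) a c‖ ^ 2
        + κ * ∑ a, ∑ c, ‖(∑ z ∈ Finset.univ.filter (fun z : ↥R => rblk n R z = b), Ψ z) a c‖ ^ 2 := by
  have hn1 : (1 : ℝ) ≤ (n : ℝ) - 1 := by
    have : (2 : ℝ) ≤ n := by exact_mod_cast hn
    linarith
  have hP0 : 0 < ((n : ℝ) - 1) * n / 2 := by nlinarith
  have hV0 : (0 : ℝ) < (n : ℝ) ^ (d + 1) := by positivity
  exact coercive_arith hP0 hV0 hκ (Finset.sum_nonneg fun _ _ => hs_nonneg _) (hs_nonneg _)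
    (hs_sum_le_poincare_mean_side hn hR b Ψ)

end SideN

end Literature.MathematicalPhysics.QuantumFieldTheory.Balaban1983to89.B9Thm31SiteCoerciveFlatBlockY
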